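/-
Public-domain reproduction (cell pub-lg7, seat 5 = assembly).  Bookkeeping over the tree's frames, no new mathematics:
the rungs `K = 5` and `K = 4` of `GoldbachLinnikTerminalRungs.lean` (GRH-shaped Lemmas 1–2 of Pintz–Ruzsa I as
hypotheses, every number a kernel certificate, flat boxes `C* ≤ 2.774` / `C* ≤ 2.156`, NO diagonal saving) re-stated over
Pintz–Ruzsa I's OWN periodised arcs (2.5) `P = √N L⁻⁸`, `Q = √N` WITH Part I's diagonal saving (8.20)–(8.22), exactly as
`GoldbachLinnikGRHLemmasDiagonalAllCert.lean` did for `K = 6`: the sufficient flat boxes become `C* ≤ 2.909` (`K = 5`) and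
`C* ≤ 2.291` (`K = 4`), against the tree's necessary `C* < 2.9322` / `C* < 2.3058` at the true constants
(`crit32_GRH_needs_Cstar_lt_aConst`, `crit22_GRH_needs_Cstar_lt_aConst`); and the three GRH rungs in level-of-distribution
currency (`C* = 2/ϑ` by the linear sieve): `K = 6` from `ϑ ≥ 0.5311`, `K = 5` from `ϑ ≥ 0.6876`, `K = 4` from `ϑ ≥ 0.873`.
GRH is NOT formalised and NOT asserted: Lemmas 1 and 2 are HYPOTHESES; no level beyond `1/2` is known.  NOT a route to
Goldbach; no `K` is claimed (published record `K = 8`, Pintz–Ruzsa II 2020; `K = 7` under GRH, Pintz–Ruzsa I); `K = 6`,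
`5`, `4` are NOT obtained; nothing is asserted about any preprint.
-/
import Literature.NumberTheory.Sieve.GoldbachLinnikGRHLemmasDiagonalAllCert
import HarnessLib

/-!
# Goldbach–Linnik under GRH over Pintz–Ruzsa I's own arcs, with the diagonal saving: the rungs `K = 5`, `K = 4`, and the level currency

Topic `Literature/NumberTheory/Sieve`.  Sequel to `GoldbachLinnikGRHLemmasDiagonalAllCert.lean` (the generic `(i, j)` frame
`goldbach_linnik_exactly_of_GRH_PR1Lemmas_flat_periodicArcs_cert` over Pintz–Ruzsa's periodised arcs at level `N^θ`, with
the mean-square constant `C = 0.6602·1.94·(C* − 1) + (log 2)/2·(1 − θ)`; print's arcs `periodicArcs (√N/L⁸) (√N)` are at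
level `N^θ` for every `θ < 1/2`; the `K = 6` box `C* ≤ 3.766`) and to `GoldbachLinnikTerminalRungs.lean` (the same rungs over
ARBITRARY measurable arcs, hence WITHOUT the saving: `K = 5` box `C* ≤ 2.774`, `K = 4` box `C* ≤ 2.156`; the floors).

* §1 numerics, `(3, 2)`: `crit32_GRH_diag2909_certA_corner_lt_one` (`norm_num`: at `C* = 2.909`, `θ = 0.4999`,
  `C = 2.61834…`, `(0.02119736 + C·λ⁴)(0.06234961 + C·λ²) = 0.99915… < 1`, `λ = 0.7163436`) and the box version
  `crit32_GRH_diag_certA_lt_one_of_Cstar_le` (`1 ≤ C* ≤ 2.909`, `0.4999 ≤ θ ≤ 1`).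
* §2 numerics, `(2, 2)`: `crit22_GRH_diag2291_certA_corner_lt_one` (`C = 1.82681…`, `(0.06234961 + C·λ²)² = 0.99955… < 1`)
  and `crit22_GRH_diag_certA_lt_one_of_Cstar_le` (`1 ≤ C* ≤ 2.291`).
* §3 the frames: **`goldbach_linnik_five_exactly_of_GRH_PR1Lemmas_printArcs_flat_allCert`** (`goldbach_linnik_exactly 5`
  from Lemma 1's two-sided shape and Lemma 2's shape over print's arcs and a flat `PairSieveBound 1 C*`, `1 ≤ C* ≤ 2.909`;
  nothing else), **`goldbach_linnik_four_exactly_of_GRH_PR1Lemmas_printArcs_flat_allCert`** (`1 ≤ C* ≤ 2.291`), their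
  `θ`-generic forms over any periodised arcs at a level `θ ≥ 0.4999`, and `K = 4` from GRH-shaped Lemmas 1–2 over print's
  arcs and the Elliott–Halberstam conjecture with NO decimal hypothesis (`…_printArcs_EH_allCert`; EH's `C* = 2 ≤ 2.291`).
* §4 level currency: with `PairSieveBound 1 (2/ϑ)` from `PrimesHaveLevel ϑ` (`pairSieveBound_of_level`, the tree's linear
  sieve), GRH-shaped Lemmas 1–2 over print's arcs give `K = 6` for `ϑ ≥ 0.5311` (`2/0.5311 = 3.7657 ≤ 3.766`; WITHOUT the
  saving the predecessor files needed `ϑ ≥ 5/9`), `K = 5` for `ϑ ≥ 0.6876`, `K = 4` for `ϑ ≥ 0.873` (was `0.721` / `0.9277`).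
  Known: `ϑ = 1/2⁻` (Bombieri–Vinogradov).  Nothing is asserted about any level beyond `1/2`.

Kernel windows for the flat constant under GRH-shaped arcs after this file (sufficient here / necessary in
`GoldbachLinnikAConstLowerCert` at the true `A(2)`, `A(3)`, `C₀R₀`, `λ ≥ 0.71634354`, `ϑ ≤ 1/2`): `K = 6` `[3.766, 3.7975)`,
**`K = 5` `[2.909, 2.9322)`**, **`K = 4` `[2.291, 2.3058)`** (was `[2.774, 2.9322)`, `[2.156, 2.3058)`); Johnston–Trudgian's
Table 1 "`C₁` required" under GRH, `5.859 = 2·2.9295` (`K = 5`) and `4.608 = 2·2.304` (`K = 4`), lie inside.  `K = 3` and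
`K = 2` have no sufficient frame in this normalisation (the generic frame needs `i, j ≥ 2`); their floors are in
`GoldbachLinnikTerminalRungs.lean` (`K = 3` needs `C* < 1.7374 < 2 =` EH's value).

An implication over named hypotheses.  **NOT A ROUTE TO GOLDBACH; no `K` is claimed (published record `K = 8`,
Pintz–Ruzsa II; `K = 7` under GRH, Pintz–Ruzsa I); `K = 6`, `5`, `4` are NOT obtained (no pair sieve with a shift-uniform
flat constant `≤ 2.909` is known, even as a preprint; EH and GRH are open and not formalised); nothing is asserted about
Lichtman's or Johnston–Trudgian's preprints.**

## References

* J. Pintz, I. Z. Ruzsa, *On Linnik's approximation to Goldbach's problem, I*, Acta Arith. 109 (2003) 169–194: Theorem 1,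
  §2 (2.2)–(2.3), Lemma 1 (2.5)–(2.6), Lemma 2 (2.9)–(2.10), §7 Corollary 1, §8 (8.14), Lemma 11 (8.20)–(8.22), §9
  Theorem 4, §10 (10.10)–(10.16). [PintzRuzsa2003]
* J. Pintz, I. Z. Ruzsa, *On Linnik's approximation to Goldbach's problem. II*, Acta Math. Hungar. 161 (2020) 569–582:
  Lemma 5 (4.2)–(4.8). [PintzRuzsa2020]
* D. R. Johnston, T. S. Trudgian, arXiv:2605.17825v2, Theorem 3 (PReq), Theorem 4, Proposition EHprop, (C2def1), Table 1
  (PRtable) — PREPRINT, hypothesis shapes and comparators only. [JohnstonTrudgian2026]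
* P. D. T. A. Elliott, H. Halberstam, *A conjecture in prime number theory*, Symposia Mathematica IV (1970) 59–72.
  [ElliottHalberstam1970Symposia]
-/

noncomputable section

open Finset Filter MeasureTheory

namespace Literature.NumberTheory.Sieve

namespace GoldbachLinnik

/-! ### §1 The `(3, 2)` criterion with the diagonal saving on the certificate-grade box -/

/-- Corner value of the `(3, 2)` criterion with the diagonal saving: at `C* = 2.909`, `θ = 0.4999`,
`C = 0.6602·1.94·1.909 + (0.6931471808/2)·0.5001 = 2.61834…` and
`(0.02119736 + C·λ⁴)(0.06234961 + C·λ²) = 0.99915… < 1`, `λ = 0.7163436`. [folklore] -/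
theorem crit32_GRH_diag2909_certA_corner_lt_one :
    ((0.02119736 : ℝ) + (0.6602 * 1.94 * ((2.909 : ℝ) - 1) + 0.6931471808 / 2 * (1 - (0.4999 : ℝ))) *
        (0.7163436 : ℝ) ^ (2 * 3 - 2)) *
      (0.06234961 + (0.6602 * 1.94 * ((2.909 : ℝ) - 1) + 0.6931471808 / 2 * (1 - (0.4999 : ℝ))) *
        (0.7163436 : ℝ) ^ (2 * 2 - 2)) < 1 := by
  norm_num

/-- Monotonicity of the mean-square constant with the saving in the box: for `1 ≤ C* ≤ B` and `0.4999 ≤ θ ≤ 1`,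
`0 ≤ 0.6602·1.94·(C* − 1) + (log 2)/2·(1 − θ) ≤ 0.6602·1.94·(B − 1) + (0.6931471808/2)·0.5001`. [folklore] -/
theorem diagC_nonneg_and_le {Cst θ B : ℝ} (hCst1 : 1 ≤ Cst) (hCst : Cst ≤ B) (hθ : 0.4999 ≤ θ) (hθ1 : θ ≤ 1) :
    (0 : ℝ) ≤ 0.6602 * 1.94 * (Cst - 1) + Real.log 2 / 2 * (1 - θ) ∧
      0.6602 * 1.94 * (Cst - 1) + Real.log 2 / 2 * (1 - θ) ≤
        0.6602 * 1.94 * (B - 1) + 0.6931471808 / 2 * (1 - (0.4999 : ℝ)) := by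
  have hl : Real.log 2 < 0.6931471808 := Real.log_two_lt_d9
  have hl0 : 0 < Real.log 2 := Real.log_pos (by norm_num)
  have hl2 : (0 : ℝ) ≤ Real.log 2 / 2 := div_nonneg hl0.le (by norm_num)
  refine ⟨add_nonneg (by nlinarith) (mul_nonneg hl2 (by linarith)), ?_⟩
  have h1 : 0.6602 * 1.94 * (Cst - 1) ≤ 0.6602 * 1.94 * (B - 1) := by nlinarith
  have h21 : Real.log 2 / 2 * (1 - θ) ≤ Real.log 2 / 2 * (1 - (0.4999 : ℝ)) :=
    mul_le_mul_of_nonneg_left (by linarith) hl2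
  have h22 : Real.log 2 / 2 * (1 - (0.4999 : ℝ)) ≤ 0.6931471808 / 2 * (1 - (0.4999 : ℝ)) :=
    mul_le_mul_of_nonneg_right (by linarith) (by norm_num)
  linarith

/-- The `(3, 2)` criterion WITH the diagonal saving for ANY flat constant `1 ≤ C* ≤ 2.909` and ANY level `0.4999 ≤ θ ≤ 1`,
at `C = 0.6602·1.94·(C* − 1) + (log 2)/2·(1 − θ)`, `λ = 0.7163436`, `A(3) ≤ 0.02119736`, `A(2) ≤ 0.06234961`.  Thresholds on
this box: `C* < 2.90990` at `θ = 0.4999` (`2.90992` at `θ = 1/2`; `2.77463` at `θ = 0`, the predecessor's box `2.774`);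
Johnston–Trudgian's Table 1 (GRH, `K = 5`, their box): `C₁ = 5.859`, i.e. `C* < 2.9295`.
[cite: JohnstonTrudgian2026, Theorem 3 (PReq), (C2def1), Table PRtable (K = 5, GRH)] -/
theorem crit32_GRH_diag_certA_lt_one_of_Cstar_le {Cst θ : ℝ} (hCst1 : 1 ≤ Cst) (hCst : Cst ≤ 2.909)
    (hθ : 0.4999 ≤ θ) (hθ1 : θ ≤ 1) :
    ((0.02119736 : ℝ) + (0.6602 * 1.94 * (Cst - 1) + Real.log 2 / 2 * (1 - θ)) * (0.7163436 : ℝ) ^ (2 * 3 - 2)) *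
      (0.06234961 + (0.6602 * 1.94 * (Cst - 1) + Real.log 2 / 2 * (1 - θ)) * (0.7163436 : ℝ) ^ (2 * 2 - 2)) < 1 := by
  obtain ⟨hC0, hCC⟩ := diagC_nonneg_and_le hCst1 hCst hθ hθ1
  exact (crit_mul_le_of_le (by norm_num) (by norm_num) (by norm_num) (by norm_num) hC0 hCC).trans_lt
    crit32_GRH_diag2909_certA_corner_lt_one

/-! ### §2 The `(2, 2)` criterion with the diagonal saving on the certificate-grade box -/

/-- Corner value of the `(2, 2)` criterion with the diagonal saving: at `C* = 2.291`, `θ = 0.4999`,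
`C = 0.6602·1.94·1.291 + (0.6931471808/2)·0.5001 = 1.82681…` and `(0.06234961 + C·λ²)² = 0.99955… < 1`, `λ = 0.7163436`.
[folklore] -/
theorem crit22_GRH_diag2291_certA_corner_lt_one :
    ((0.06234961 : ℝ) + (0.6602 * 1.94 * ((2.291 : ℝ) - 1) + 0.6931471808 / 2 * (1 - (0.4999 : ℝ))) *
        (0.7163436 : ℝ) ^ (2 * 2 - 2)) *
      (0.06234961 + (0.6602 * 1.94 * ((2.291 : ℝ) - 1) + 0.6931471808 / 2 * (1 - (0.4999 : ℝ))) *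
        (0.7163436 : ℝ) ^ (2 * 2 - 2)) < 1 := by
  norm_num

/-- The `(2, 2)` criterion WITH the diagonal saving for ANY flat constant `1 ≤ C* ≤ 2.291` and ANY level `0.4999 ≤ θ ≤ 1`,
at `C = 0.6602·1.94·(C* − 1) + (log 2)/2·(1 − θ)`, `λ = 0.7163436`, `A(2) ≤ 0.06234961`.  Thresholds on this box:
`C* < 2.29133` at `θ = 0.4999` (`2.29136` at `θ = 1/2`; `2.15606` at `θ = 0`, the predecessor's box `2.156`);
Johnston–Trudgian's Table 1 (GRH, `K = 4`, their box): `C₁ = 4.608`, i.e. `C* < 2.304`.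
[cite: JohnstonTrudgian2026, Theorem 3 (PReq), (C2def1), Table PRtable (K = 4, GRH)] -/
theorem crit22_GRH_diag_certA_lt_one_of_Cstar_le {Cst θ : ℝ} (hCst1 : 1 ≤ Cst) (hCst : Cst ≤ 2.291)
    (hθ : 0.4999 ≤ θ) (hθ1 : θ ≤ 1) :
    ((0.06234961 : ℝ) + (0.6602 * 1.94 * (Cst - 1) + Real.log 2 / 2 * (1 - θ)) * (0.7163436 : ℝ) ^ (2 * 2 - 2)) *
      (0.06234961 + (0.6602 * 1.94 * (Cst - 1) + Real.log 2 / 2 * (1 - θ)) * (0.7163436 : ℝ) ^ (2 * 2 - 2)) < 1 := by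
  obtain ⟨hC0, hCC⟩ := diagC_nonneg_and_le hCst1 hCst hθ hθ1
  exact (crit_mul_le_of_le (by norm_num) (by norm_num) (by norm_num) (by norm_num) hC0 hCC).trans_lt
    crit22_GRH_diag2291_certA_corner_lt_one

/-! ### §3 The frames: `K = 5` and `K = 4` from Lemmas 1–2 over the periodised arcs / print's arcs, flat boxes with the saving -/

/-- **`K = 5` under GRH-shaped Lemmas 1–2 over ANY periodised arcs at a level `θ ≥ 0.4999`, flat `C* ≤ 2.909`, exact form.**
Hypotheses — all of them: the levels `N^θ ≤ P_N`, `N^θ ≤ Q_N ≤ N^{1−θ}` with `0.4999 ≤ θ ≤ 1`; Lemma 1's two-sided shape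
`hL1` and Lemma 2's shape `hL2` over `periodicArcs (P N) (Q N)` (GRH in print; HYPOTHESES here); `PairSieveBound 1 C*` with
`1 ≤ C* ≤ 2.909` (no pair sieve with such a shift-uniform constant is known, even as a preprint: Lichtman's is `3.3907`; EH
would give `2`; by `crit32_GRH_needs_Cstar_lt_aConst` no flat constant `≥ 2.9322` can work on GRH-shaped arcs).  Everything
else is a theorem of the tree (`λ = 0.7163436`, `R₀ ≤ 1.94`, `C₀ ≤ 0.6602`, `A(3) ≤ 0.02119736`, `A(2) ≤ 0.06234961`;
criterion `crit32_GRH_diag_certA_lt_one_of_Cstar_le`).  NOT a route to Goldbach; `K = 5` is NOT obtained; nothing asserted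
about GRH. [cite: PintzRuzsa2003, (2.2)–(2.3), Lemma 1 (2.5)–(2.6), Lemma 2 (2.9)–(2.10), §7 Corollary 1, (8.14), Lemma 11 (8.20)–(8.22), §9 Theorem 4, §10 (10.10)–(10.16)]
[cite: JohnstonTrudgian2026, Theorem 3 (PReq), (C2def1), Table PRtable (K = 5, GRH)] -/
theorem goldbach_linnik_five_exactly_of_GRH_PR1Lemmas_flat_periodicArcs_allCert
    {P Q : ℕ → ℝ} {θ : ℝ} (hθ : 0.4999 ≤ θ) (hθ1 : θ ≤ 1)
    (hP : ∀ᶠ N : ℕ in atTop, (N : ℝ) ^ θ ≤ P N) (hQ1 : ∀ᶠ N : ℕ in atTop, (N : ℝ) ^ θ ≤ Q N)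
    (hQ2 : ∀ᶠ N : ℕ in atTop, Q N ≤ (N : ℝ) ^ (1 - θ))
    {Cst : ℝ} (hCst1 : 1 ≤ Cst) (hCst : Cst ≤ 2.909) (hflat : PairSieveBound 1 Cst) {Cerr : ℝ}
    (hL1 : ∀ᶠ N : ℕ in atTop, ∀ h : ℤ, h ≠ 0 → Even h →
      |majorArcPairIntegral (periodicArcs (P N) (Q N)) N h -
        goldbachSingularSeries h.natAbs * max ((N : ℝ) - |(h : ℝ)|) 0 / Real.log N ^ 2| ≤
        Cerr * N / (powLen N : ℝ) ^ 3)
    {CU : ℝ}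
    (hL2 : ∀ᶠ N : ℕ in atTop, ∀ α ∈ Set.Icc (0 : ℝ) 1 \ periodicArcs (P N) (Q N),
      ‖primeSum N α‖ ≤ CU * (N : ℝ) ^ (3 / 4 : ℝ) * (powLen N : ℝ) ^ 2) :
    goldbach_linnik_exactly 5 :=
  goldbach_linnik_exactly_of_GRH_PR1Lemmas_flat_periodicArcs_cert (i := 3) (j := 2) (by norm_num) (by norm_num)
    (by linarith) hθ1 hP hQ1 hQ2 hCst1 hflat aConst_three_le_certA (by norm_num) aConst_two_le_certA (by norm_num)
    (crit32_GRH_diag_certA_lt_one_of_Cstar_le hCst1 hCst hθ hθ1) hL1 hL2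

/-- **`K = 5` from Lemmas 1 and 2 of Pintz–Ruzsa I over PRINT'S OWN ARCS (2.5) `P = √N L⁻⁸`, `Q = √N` and a flat pair-sieve
constant `C* ≤ 2.909`, exact form.**  Hypotheses — all of them: `hL1` (Lemma 1 verbatim over `periodicArcs (√N/L⁸) (√N)`),
`hL2` (Lemma 2 verbatim off those arcs) — GRH in print, HYPOTHESES here; `PairSieveBound 1 C*` with `1 ≤ C* ≤ 2.909`.  No
measurability hypothesis; the level `θ = 0.4999` is supplied by `GoldbachLinnikGRHLemmasDiagonalAllCert` §3; every number is a
kernel theorem.  **The only decimal among the hypotheses is the box `C* ≤ 2.909`.**  Kernel window for the flat constant of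
GRH-shaped `K = 5`: sufficient `≤ 2.909` (here) — necessary `< 2.9322` (`crit32_GRH_needs_Cstar_lt_aConst`);
Johnston–Trudgian's `5.859 = 2·2.9295` inside.  NOT a route to Goldbach; `K = 5` is NOT obtained (no such sieve constant is
known); nothing is asserted about GRH or any preprint.
[cite: PintzRuzsa2003, (2.2)–(2.3), Lemma 1 (2.5)–(2.6), Lemma 2 (2.9)–(2.10), §7 Corollary 1, (8.14), Lemma 11 (8.20)–(8.22), §9 Theorem 4, §10 (10.10)–(10.16)]
[cite: JohnstonTrudgian2026, Theorem 3 (PReq), (C2def1), Table PRtable (K = 5, GRH)] -/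
theorem goldbach_linnik_five_exactly_of_GRH_PR1Lemmas_printArcs_flat_allCert
    {Cst : ℝ} (hCst1 : 1 ≤ Cst) (hCst : Cst ≤ 2.909) (hflat : PairSieveBound 1 Cst) {Cerr : ℝ}
    (hL1 : ∀ᶠ N : ℕ in atTop, ∀ h : ℤ, h ≠ 0 → Even h →
      |majorArcPairIntegral (periodicArcs (Real.sqrt N / (powLen N : ℝ) ^ 8) (Real.sqrt N)) N h -
        goldbachSingularSeries h.natAbs * max ((N : ℝ) - |(h : ℝ)|) 0 / Real.log N ^ 2| ≤
        Cerr * N / (powLen N : ℝ) ^ 3)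
    {CU : ℝ}
    (hL2 : ∀ᶠ N : ℕ in atTop, ∀ α ∈ Set.Icc (0 : ℝ) 1 \ periodicArcs (Real.sqrt N / (powLen N : ℝ) ^ 8) (Real.sqrt N),
      ‖primeSum N α‖ ≤ CU * (N : ℝ) ^ (3 / 4 : ℝ) * (powLen N : ℝ) ^ 2) :
    goldbach_linnik_exactly 5 :=
  goldbach_linnik_five_exactly_of_GRH_PR1Lemmas_flat_periodicArcs_allCert
    (P := fun N => Real.sqrt N / (powLen N : ℝ) ^ 8) (Q := fun N => Real.sqrt N) (θ := 0.4999) le_rfl (by norm_num)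
    (eventually_rpow_le_sqrt_div_powLen_pow (by norm_num) 8) (eventually_rpow_le_sqrt (by norm_num))
    (eventually_sqrt_le_rpow_one_sub (by norm_num)) hCst1 hCst hflat hL1 hL2

/-- **`K = 4` under GRH-shaped Lemmas 1–2 over ANY periodised arcs at a level `θ ≥ 0.4999`, flat `C* ≤ 2.291`, exact form**
(hypotheses exactly as in `goldbach_linnik_five_exactly_of_GRH_PR1Lemmas_flat_periodicArcs_allCert` with the box `C* ≤ 2.291`;
the Elliott–Halberstam value `C* = 2` satisfies it).  By `crit22_GRH_needs_Cstar_lt_aConst` no flat constant `≥ 2.3058` can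
work on GRH-shaped arcs.  NOT a route to Goldbach; `K = 4` NOT obtained; nothing asserted about GRH.
[cite: PintzRuzsa2003, (2.2)–(2.3), Lemma 1 (2.5)–(2.6), Lemma 2 (2.9)–(2.10), §7 Corollary 1, (8.14), Lemma 11 (8.20)–(8.22), §9 Theorem 4, §10 (10.10)–(10.16)]
[cite: JohnstonTrudgian2026, Theorem 3 (PReq), (C2def1), Table PRtable (K = 4, GRH)] -/
theorem goldbach_linnik_four_exactly_of_GRH_PR1Lemmas_flat_periodicArcs_allCert
    {P Q : ℕ → ℝ} {θ : ℝ} (hθ : 0.4999 ≤ θ) (hθ1 : θ ≤ 1)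
    (hP : ∀ᶠ N : ℕ in atTop, (N : ℝ) ^ θ ≤ P N) (hQ1 : ∀ᶠ N : ℕ in atTop, (N : ℝ) ^ θ ≤ Q N)
    (hQ2 : ∀ᶠ N : ℕ in atTop, Q N ≤ (N : ℝ) ^ (1 - θ))
    {Cst : ℝ} (hCst1 : 1 ≤ Cst) (hCst : Cst ≤ 2.291) (hflat : PairSieveBound 1 Cst) {Cerr : ℝ}
    (hL1 : ∀ᶠ N : ℕ in atTop, ∀ h : ℤ, h ≠ 0 → Even h →
      |majorArcPairIntegral (periodicArcs (P N) (Q N)) N h -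
        goldbachSingularSeries h.natAbs * max ((N : ℝ) - |(h : ℝ)|) 0 / Real.log N ^ 2| ≤
        Cerr * N / (powLen N : ℝ) ^ 3)
    {CU : ℝ}
    (hL2 : ∀ᶠ N : ℕ in atTop, ∀ α ∈ Set.Icc (0 : ℝ) 1 \ periodicArcs (P N) (Q N),
      ‖primeSum N α‖ ≤ CU * (N : ℝ) ^ (3 / 4 : ℝ) * (powLen N : ℝ) ^ 2) :
    goldbach_linnik_exactly 4 :=
  goldbach_linnik_exactly_of_GRH_PR1Lemmas_flat_periodicArcs_cert (i := 2) (j := 2) (by norm_num) (by norm_num)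
    (by linarith) hθ1 hP hQ1 hQ2 hCst1 hflat aConst_two_le_certA (by norm_num) aConst_two_le_certA (by norm_num)
    (crit22_GRH_diag_certA_lt_one_of_Cstar_le hCst1 hCst hθ hθ1) hL1 hL2

/-- **`K = 4` from Lemmas 1 and 2 of Pintz–Ruzsa I over PRINT'S OWN ARCS and a flat pair-sieve constant `C* ≤ 2.291`, exact
form.**  Hypotheses: `hL1`, `hL2` over `periodicArcs (√N/L⁸) (√N)` (GRH-shaped, hypotheses); `PairSieveBound 1 C*` with
`1 ≤ C* ≤ 2.291` (the only decimal).  Kernel window for GRH-shaped `K = 4`: sufficient `≤ 2.291` (here) — necessary `< 2.3058`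
(`crit22_GRH_needs_Cstar_lt_aConst`); Johnston–Trudgian's `4.608 = 2·2.304` inside.  NOT a route to Goldbach; `K = 4` is NOT
obtained; nothing asserted about GRH or any preprint.
[cite: PintzRuzsa2003, (2.2)–(2.3), Lemma 1 (2.5)–(2.6), Lemma 2 (2.9)–(2.10), §7 Corollary 1, (8.14), Lemma 11 (8.20)–(8.22), §9 Theorem 4, §10 (10.10)–(10.16)]
[cite: JohnstonTrudgian2026, Theorem 3 (PReq), (C2def1), Table PRtable (K = 4, GRH)] -/
theorem goldbach_linnik_four_exactly_of_GRH_PR1Lemmas_printArcs_flat_allCert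
    {Cst : ℝ} (hCst1 : 1 ≤ Cst) (hCst : Cst ≤ 2.291) (hflat : PairSieveBound 1 Cst) {Cerr : ℝ}
    (hL1 : ∀ᶠ N : ℕ in atTop, ∀ h : ℤ, h ≠ 0 → Even h →
      |majorArcPairIntegral (periodicArcs (Real.sqrt N / (powLen N : ℝ) ^ 8) (Real.sqrt N)) N h -
        goldbachSingularSeries h.natAbs * max ((N : ℝ) - |(h : ℝ)|) 0 / Real.log N ^ 2| ≤
        Cerr * N / (powLen N : ℝ) ^ 3)
    {CU : ℝ}
    (hL2 : ∀ᶠ N : ℕ in atTop, ∀ α ∈ Set.Icc (0 : ℝ) 1 \ periodicArcs (Real.sqrt N / (powLen N : ℝ) ^ 8) (Real.sqrt N),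
      ‖primeSum N α‖ ≤ CU * (N : ℝ) ^ (3 / 4 : ℝ) * (powLen N : ℝ) ^ 2) :
    goldbach_linnik_exactly 4 :=
  goldbach_linnik_four_exactly_of_GRH_PR1Lemmas_flat_periodicArcs_allCert
    (P := fun N => Real.sqrt N / (powLen N : ℝ) ^ 8) (Q := fun N => Real.sqrt N) (θ := 0.4999) le_rfl (by norm_num)
    (eventually_rpow_le_sqrt_div_powLen_pow (by norm_num) 8) (eventually_rpow_le_sqrt (by norm_num))
    (eventually_sqrt_le_rpow_one_sub (by norm_num)) hCst1 hCst hflat hL1 hL2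

/-- **`K = 4` from GRH-shaped Lemmas 1–2 of Pintz–Ruzsa I over PRINT'S OWN ARCS and the Elliott–Halberstam conjecture, NOTHING
ELSE** (the predecessor's `goldbach_linnik_four_exactly_of_GRH_PR1Lemmas_EH_allCert` with the arcs instantiated and
measurability discharged; the saving is not needed here: EH's `C* = 2` is inside the box without it).  Hypotheses: `hL1`, `hL2`
(GRH-shaped, hypotheses) and `ElliottHalberstam` (the tree's `def`, OPEN, a hypothesis; `PairSieveBound 1 2` is DERIVED from it
by `pairSieveBound_one_two_of_EH`).  **No decimal is a hypothesis.**  NOT a route to Goldbach; `K = 4` is NOT obtained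
(conditional on GRH-shaped arcs AND EH); nothing is asserted about GRH or EH.
[cite: JohnstonTrudgian2026, Theorem 4, Proposition EHprop, Theorem 3] [cite: PintzRuzsa2003, Lemma 1 (2.5)–(2.6), Lemma 2 (2.9)–(2.10), §10 (10.10)–(10.16)]
[cite: ElliottHalberstam1970Symposia, Conjecture] -/
theorem goldbach_linnik_four_exactly_of_GRH_PR1Lemmas_printArcs_EH_allCert
    (hEH : LevelOfDistribution.ElliottHalberstam) {Cerr : ℝ}
    (hL1 : ∀ᶠ N : ℕ in atTop, ∀ h : ℤ, h ≠ 0 → Even h →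
      |majorArcPairIntegral (periodicArcs (Real.sqrt N / (powLen N : ℝ) ^ 8) (Real.sqrt N)) N h -
        goldbachSingularSeries h.natAbs * max ((N : ℝ) - |(h : ℝ)|) 0 / Real.log N ^ 2| ≤
        Cerr * N / (powLen N : ℝ) ^ 3)
    {CU : ℝ}
    (hL2 : ∀ᶠ N : ℕ in atTop, ∀ α ∈ Set.Icc (0 : ℝ) 1 \ periodicArcs (Real.sqrt N / (powLen N : ℝ) ^ 8) (Real.sqrt N),
      ‖primeSum N α‖ ≤ CU * (N : ℝ) ^ (3 / 4 : ℝ) * (powLen N : ℝ) ^ 2) :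
    goldbach_linnik_exactly 4 :=
  goldbach_linnik_four_exactly_of_GRH_PR1Lemmas_printArcs_flat_allCert (Cst := 2) (by norm_num) (by norm_num)
    (pairSieveBound_one_two_of_EH hEH) hL1 hL2

/-- The at-most form (`goldbach_linnik_with 4`) of `goldbach_linnik_four_exactly_of_GRH_PR1Lemmas_printArcs_EH_allCert`.  NOT
a route to Goldbach; `K = 4` NOT obtained; nothing asserted about GRH or EH. [cite: JohnstonTrudgian2026, Theorem 4]
[cite: PintzRuzsa2003, Lemma 1 (2.5)–(2.6), Lemma 2 (2.9)–(2.10)] -/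
theorem goldbach_linnik_four_of_GRH_PR1Lemmas_printArcs_EH_allCert
    (hEH : LevelOfDistribution.ElliottHalberstam) {Cerr : ℝ}
    (hL1 : ∀ᶠ N : ℕ in atTop, ∀ h : ℤ, h ≠ 0 → Even h →
      |majorArcPairIntegral (periodicArcs (Real.sqrt N / (powLen N : ℝ) ^ 8) (Real.sqrt N)) N h -
        goldbachSingularSeries h.natAbs * max ((N : ℝ) - |(h : ℝ)|) 0 / Real.log N ^ 2| ≤
        Cerr * N / (powLen N : ℝ) ^ 3)
    {CU : ℝ}
    (hL2 : ∀ᶠ N : ℕ in atTop, ∀ α ∈ Set.Icc (0 : ℝ) 1 \ periodicArcs (Real.sqrt N / (powLen N : ℝ) ^ 8) (Real.sqrt N),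
      ‖primeSum N α‖ ≤ CU * (N : ℝ) ^ (3 / 4 : ℝ) * (powLen N : ℝ) ^ 2) :
    goldbach_linnik_with 4 :=
  goldbach_linnik_with_of_exactly (goldbach_linnik_four_exactly_of_GRH_PR1Lemmas_printArcs_EH_allCert hEH hL1 hL2)

/-! ### §4 Level currency: `K = 6`, `5`, `4` from GRH-shaped Lemmas 1–2 over print's arcs and primes of level `ϑ` -/

/-- **`K = 6` from GRH-shaped Lemmas 1–2 over print's arcs and a level of distribution `ϑ ≥ 0.5311` of the primes**
(`PrimesHaveLevel ϑ`, the tree's Bombieri–Vinogradov-type statement at level `x^ϑ`, known for `ϑ ≤ 1/2` only; the linear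
sieve gives `PairSieveBound 1 (2/ϑ)`, `pairSieveBound_of_level`, and `2/0.5311 = 3.7657… ≤ 3.766`).  WITHOUT the diagonal saving
the predecessor files needed `ϑ ≥ 5/9` (`2/(5/9) = 3.6`).  NOT a route to Goldbach; `K = 6` NOT obtained or claimed; nothing
asserted about GRH or any level beyond `1/2`.
[cite: PintzRuzsa2003, Lemma 1 (2.5)–(2.6), Lemma 2 (2.9)–(2.10), Lemma 11 (8.20)–(8.22), §10 (10.10)–(10.16)] [cite: JohnstonTrudgian2026, Theorem 1.1 (GRHGoldLin), Proposition EHprop] -/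
theorem goldbach_linnik_six_exactly_of_GRH_PR1Lemmas_printArcs_level {ϑ : ℝ} (hLϑ : PrimesHaveLevel ϑ) (hϑ : 0.5311 ≤ ϑ)
    {Cerr : ℝ}
    (hL1 : ∀ᶠ N : ℕ in atTop, ∀ h : ℤ, h ≠ 0 → Even h →
      |majorArcPairIntegral (periodicArcs (Real.sqrt N / (powLen N : ℝ) ^ 8) (Real.sqrt N)) N h -
        goldbachSingularSeries h.natAbs * max ((N : ℝ) - |(h : ℝ)|) 0 / Real.log N ^ 2| ≤
        Cerr * N / (powLen N : ℝ) ^ 3)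
    {CU : ℝ}
    (hL2 : ∀ᶠ N : ℕ in atTop, ∀ α ∈ Set.Icc (0 : ℝ) 1 \ periodicArcs (Real.sqrt N / (powLen N : ℝ) ^ 8) (Real.sqrt N),
      ‖primeSum N α‖ ≤ CU * (N : ℝ) ^ (3 / 4 : ℝ) * (powLen N : ℝ) ^ 2) :
    goldbach_linnik_exactly 6 := by
  have hϑ0 : 0 < ϑ := by linarith
  have hdiv : 2 / ϑ ≤ 2 / (0.5311 : ℝ) := div_le_div_of_nonneg_left (by norm_num) (by norm_num) hϑ
  have hPS : PairSieveBound 1 (2 / (0.5311 : ℝ)) := (pairSieveBound_of_level hLϑ hϑ0).mono le_rfl hdiv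
  exact goldbach_linnik_six_exactly_of_GRH_PR1Lemmas_printArcs_flat_allCert (Cst := 2 / 0.5311) (by norm_num) (by norm_num)
    hPS hL1 hL2

/-- **`K = 5` from GRH-shaped Lemmas 1–2 over print's arcs and a level of distribution `ϑ ≥ 0.6876`** (`2/0.6876 = 2.9086… ≤ 2.909`;
WITHOUT the saving: `ϑ ≥ 0.721`, `goldbach_linnik_five_exactly_of_GRH_PR1Lemmas_level`).  NOT a route to Goldbach; `K = 5` NOT
claimed; nothing asserted about GRH or any level beyond `1/2`.
[cite: PintzRuzsa2003, Lemma 1, Lemma 2, Lemma 11 (8.20)–(8.22), §10 (10.10)–(10.16)] [cite: JohnstonTrudgian2026, Theorem 3, Proposition EHprop] -/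
theorem goldbach_linnik_five_exactly_of_GRH_PR1Lemmas_printArcs_level {ϑ : ℝ} (hLϑ : PrimesHaveLevel ϑ) (hϑ : 0.6876 ≤ ϑ)
    {Cerr : ℝ}
    (hL1 : ∀ᶠ N : ℕ in atTop, ∀ h : ℤ, h ≠ 0 → Even h →
      |majorArcPairIntegral (periodicArcs (Real.sqrt N / (powLen N : ℝ) ^ 8) (Real.sqrt N)) N h -
        goldbachSingularSeries h.natAbs * max ((N : ℝ) - |(h : ℝ)|) 0 / Real.log N ^ 2| ≤
        Cerr * N / (powLen N : ℝ) ^ 3)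
    {CU : ℝ}
    (hL2 : ∀ᶠ N : ℕ in atTop, ∀ α ∈ Set.Icc (0 : ℝ) 1 \ periodicArcs (Real.sqrt N / (powLen N : ℝ) ^ 8) (Real.sqrt N),
      ‖primeSum N α‖ ≤ CU * (N : ℝ) ^ (3 / 4 : ℝ) * (powLen N : ℝ) ^ 2) :
    goldbach_linnik_exactly 5 := by
  have hϑ0 : 0 < ϑ := by linarith
  have hdiv : 2 / ϑ ≤ 2 / (0.6876 : ℝ) := div_le_div_of_nonneg_left (by norm_num) (by norm_num) hϑ
  have hPS : PairSieveBound 1 (2 / (0.6876 : ℝ)) := (pairSieveBound_of_level hLϑ hϑ0).mono le_rfl hdiv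
  exact goldbach_linnik_five_exactly_of_GRH_PR1Lemmas_printArcs_flat_allCert (Cst := 2 / 0.6876) (by norm_num) (by norm_num)
    hPS hL1 hL2

/-- **`K = 4` from GRH-shaped Lemmas 1–2 over print's arcs and a level of distribution `ϑ ≥ 0.873`** (`2/0.873 = 2.2909… ≤ 2.291`;
WITHOUT the saving: `ϑ ≥ 0.9277`, `goldbach_linnik_four_exactly_of_GRH_PR1Lemmas_level`).  NOT a route to Goldbach; `K = 4` NOT
claimed; nothing asserted about GRH or any level beyond `1/2`.
[cite: PintzRuzsa2003, Lemma 1, Lemma 2, Lemma 11 (8.20)–(8.22), §10 (10.10)–(10.16)] [cite: JohnstonTrudgian2026, Theorem 3, Proposition EHprop] -/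
theorem goldbach_linnik_four_exactly_of_GRH_PR1Lemmas_printArcs_level {ϑ : ℝ} (hLϑ : PrimesHaveLevel ϑ) (hϑ : 0.873 ≤ ϑ)
    {Cerr : ℝ}
    (hL1 : ∀ᶠ N : ℕ in atTop, ∀ h : ℤ, h ≠ 0 → Even h →
      |majorArcPairIntegral (periodicArcs (Real.sqrt N / (powLen N : ℝ) ^ 8) (Real.sqrt N)) N h -
        goldbachSingularSeries h.natAbs * max ((N : ℝ) - |(h : ℝ)|) 0 / Real.log N ^ 2| ≤
        Cerr * N / (powLen N : ℝ) ^ 3)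
    {CU : ℝ}
    (hL2 : ∀ᶠ N : ℕ in atTop, ∀ α ∈ Set.Icc (0 : ℝ) 1 \ periodicArcs (Real.sqrt N / (powLen N : ℝ) ^ 8) (Real.sqrt N),
      ‖primeSum N α‖ ≤ CU * (N : ℝ) ^ (3 / 4 : ℝ) * (powLen N : ℝ) ^ 2) :
    goldbach_linnik_exactly 4 := by
  have hϑ0 : 0 < ϑ := by linarith
  have hdiv : 2 / ϑ ≤ 2 / (0.873 : ℝ) := div_le_div_of_nonneg_left (by norm_num) (by norm_num) hϑ
  have hPS : PairSieveBound 1 (2 / (0.873 : ℝ)) := (pairSieveBound_of_level hLϑ hϑ0).mono le_rfl hdiv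
  exact goldbach_linnik_four_exactly_of_GRH_PR1Lemmas_printArcs_flat_allCert (Cst := 2 / 0.873) (by norm_num) (by norm_num)
    hPS hL1 hL2

end GoldbachLinnik

end Literature.NumberTheory.Sieve
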